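import Summits.Ventures.HodgeRepro2.T5SU11JacobiPhaseTailGroup
import Summits.Ventures.HodgeRepro2.T5SU11SphericalAsymptotic

/-!
# The large-deviation rate of the phase at fixed weight: `P_{k,λ}(log|a| > x) ∼ C e^{−(k−2+λ)x}` for `λ < 1`

At fixed weight `k` the tail of the phase under `m_k φ_λ dν` decays exponentially in `x`, with the rate
`k − 2 + λ` dictated by Harish-Chandra's asymptotic `e^{λt} φ_λ(a_t) → c(λ)` (`T5SU11SphericalAsymptotic`,
`λ < 1`). In the phase variable, `t(s) − s → log 2` (`tendsto_cartanOfPhase_sub`: `e^{t(s)} = e^s + √(e^{2s} − 1)`),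
so **`e^{λs} Φ_λ(s) → c(λ) 2^{−λ}`** (`tendsto_exp_mul_sphPhase`), and the tail
`∫_x^∞ e^{−(k−2)s} Φ_λ(s) ds = ∫_0^∞ e^{−(k−2+λ)(x+v)} e^{λ(x+v)} Φ_λ(x+v) dv` gives, by dominated
convergence as `x → ∞`,

  **`e^{(k−2+λ)x} ∫_x^∞ e^{−(k−2)s} Φ_λ(s) ds → c(λ) 2^{−λ}/(k − 2 + λ)`**   (`tendsto_exp_mul_tail`)

and on the group **`e^{(k−2+λ)x} P_{k,λ}(log|a| > x) → 2π c(λ) 2^{−λ}/((k − 2 + λ) m̂_k(λ))`**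
(`tendsto_exp_mul_tail_prob`): the phase of the explicit model has the exact large-deviation rate
`k − 2 + λ` for `λ < 1` (and, by `φ_λ = φ_{2−λ}`, the rate `k − λ` for `λ > 1`, `tendsto_exp_mul_tail'`) —
at `λ = 0` the rate `k − 2` of the exact exponential law (`T5SU11PhaseTail`). Nothing is claimed about (N).

Blind lane: Mathlib + the HodgeRepro2 prefix only; no sorry; axioms ⊆ {propext, Classical.choice,
Quot.sound}.
-/

namespace Summit.Ventures.HodgeRepro2.T5SU11JacobiPhaseTailRate

open MeasureTheory MeasureTheory.Measure Metric Set Filter Topology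
open T5SU11Unimodular T5SU11Fibration T5SU11Cartan T5SU11OneParameter T5SU11CartanProjection T5HaarCircle
  T5BergmanCoefficient T5SU11FibrationHaar T5SU11SphericalFunction T5SU11SphericalSymmetry
  T5SU11SphericalBounds T5SU11SphericalContinuous T5SU11JacobiIwasawa T5SU11JacobiTransform
  T5SU11JacobiWeight T5SU11KFiniteMajorantPow T5SU11JacobiWeightDeriv T5SU11PhaseLaw
  T5SU11PhaseLawLintegral T5SU11JacobiLaplacePhase T5SU11PhaseTail T5SU11JacobiPhaseTailGroup
  T5SU11SphericalAsymptotic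
open scoped Real

/-! ### The Cartan coordinate of the phase at infinity: `t(s) − s → log 2` -/

/-- `e^{t(s)} = √(e^{2s} − 1) + e^s` for `s ≥ 0`. -/
theorem exp_cartanOfPhase {s : ℝ} (hs : 0 ≤ s) :
    Real.exp (cartanOfPhase s) = Real.sqrt (Real.exp (2 * s) - 1) + Real.exp s := by
  unfold cartanOfPhase
  rw [Real.exp_arsinh]
  congr 1
  have h1 : 0 ≤ Real.exp (2 * s) - 1 := by
    have := Real.one_le_exp (by linarith : 0 ≤ 2 * s)
    linarith
  rw [Real.sq_sqrt h1, show (1 : ℝ) + (Real.exp (2 * s) - 1) = Real.exp s ^ 2 by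
    rw [← Real.exp_nat_mul]; push_cast; ring_nf, Real.sqrt_sq (Real.exp_pos s).le]

/-- `s ≤ t(s)` for `s ≥ 0`. -/
theorem le_cartanOfPhase {s : ℝ} (hs : 0 ≤ s) : s ≤ cartanOfPhase s := by
  rw [← Real.exp_le_exp, exp_cartanOfPhase hs]
  have := Real.sqrt_nonneg (Real.exp (2 * s) - 1)
  linarith

/-- `t(s) → ∞` as `s → ∞`. -/
theorem tendsto_cartanOfPhase_atTop : Tendsto cartanOfPhase atTop atTop := by
  refine tendsto_atTop_mono' atTop ?_ tendsto_id
  filter_upwards [eventually_ge_atTop (0 : ℝ)] with s hs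
  exact le_cartanOfPhase hs

/-- `e^{t(s) − s} = √(1 − e^{−2s}) + 1` for `s ≥ 0`. -/
theorem exp_cartanOfPhase_sub {s : ℝ} (hs : 0 ≤ s) :
    Real.exp (cartanOfPhase s - s) = Real.sqrt (1 - Real.exp (-(2 * s))) + 1 := by
  rw [Real.exp_sub, exp_cartanOfPhase hs, add_div, div_self (Real.exp_pos s).ne']
  congr 1
  have hpos : 0 < Real.exp s := Real.exp_pos s
  rw [show Real.exp s = Real.sqrt (Real.exp s ^ 2) from (Real.sqrt_sq hpos.le).symm,
    ← Real.sqrt_div' _ (sq_nonneg _)]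
  congr 1
  rw [show Real.exp s ^ 2 = Real.exp (2 * s) by rw [← Real.exp_nat_mul]; push_cast; ring_nf,
    sub_div, div_self (Real.exp_pos _).ne', Real.exp_neg, one_div]

/-- **`t(s) − s → log 2`** as `s → ∞`. -/
theorem tendsto_cartanOfPhase_sub : Tendsto (fun s => cartanOfPhase s - s) atTop (𝓝 (Real.log 2)) := by
  have h1 : Tendsto (fun s : ℝ => Real.exp (-(2 * s))) atTop (𝓝 0) :=
    Real.tendsto_exp_neg_atTop_nhds_zero.comp (tendsto_id.const_mul_atTop two_pos)
  have h2 : Tendsto (fun s : ℝ => Real.sqrt (1 - Real.exp (-(2 * s))) + 1) atTop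
      (𝓝 (Real.sqrt (1 - 0) + 1)) :=
    (Real.continuous_sqrt.tendsto _ |>.comp (tendsto_const_nhds.sub h1)).add tendsto_const_nhds
  rw [sub_zero, Real.sqrt_one, one_add_one_eq_two] at h2
  have h3 : Tendsto (fun s : ℝ => Real.log (Real.sqrt (1 - Real.exp (-(2 * s))) + 1)) atTop
      (𝓝 (Real.log 2)) :=
    (Real.continuousAt_log two_ne_zero).tendsto.comp h2
  refine h3.congr' ?_
  filter_upwards [eventually_ge_atTop (0 : ℝ)] with s hs
  rw [← exp_cartanOfPhase_sub hs, Real.log_exp]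

/-- The tail as an integral over `(0, ∞)` after the shift `s = x + v`. -/
theorem tail_shift (g : ℝ → ℝ) (x : ℝ) :
    ∫ s in Ioi x, g s = ∫ v in Ioi (0 : ℝ), g (v + x) := by
  rw [← integral_indicator measurableSet_Ioi, ← integral_indicator measurableSet_Ioi,
    ← integral_add_right_eq_self (fun s => (Ioi x).indicator g s) x]
  refine integral_congr_ae (Filter.Eventually.of_forall fun v => ?_)
  simp only
  by_cases hv : v ∈ Ioi (0 : ℝ)
  · have : v + x ∈ Ioi x := by rw [mem_Ioi] at hv ⊢; linarith
    rw [indicator_of_mem this, indicator_of_mem hv]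
  · have : v + x ∉ Ioi x := by rw [mem_Ioi, not_lt] at hv ⊢; linarith
    rw [indicator_of_notMem this, indicator_of_notMem hv]

section measure

variable [MeasurableSpace Circle] [BorelSpace Circle]

/-- **`e^{λs} Φ_λ(s) → c(λ) 2^{−λ}`** as `s → ∞`, for `λ < 1` (Harish-Chandra's asymptotic in the phase
variable; `2^{−λ}` written as `e^{−λ log 2}`). -/
theorem tendsto_exp_mul_sphPhase {lam : ℝ} (hlam : lam < 1) :
    Tendsto (fun s : ℝ => Real.exp (lam * s) * sphPhase lam s) atTop
      (𝓝 (cfun lam * Real.exp (-(lam * Real.log 2)))) := by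
  have hA := (tendsto_exp_mul_sph_hyp hlam).comp tendsto_cartanOfPhase_atTop
  have hB : Tendsto (fun s : ℝ => Real.exp (-(lam * (cartanOfPhase s - s)))) atTop
      (𝓝 (Real.exp (-(lam * Real.log 2)))) :=
    Real.continuous_exp.continuousAt.tendsto.comp (tendsto_cartanOfPhase_sub.const_mul lam).neg
  refine (hA.mul hB).congr' (Filter.Eventually.of_forall fun s => ?_)
  simp only [Function.comp_apply, sphPhase]
  rw [mul_right_comm, ← Real.exp_add]
  congr 2
  ring

/-- **THE LARGE-DEVIATION RATE OF THE PHASE**: for `k` on the ray and `λ < 1`,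
`e^{(k−2+λ)x} ∫_x^∞ e^{−(k−2)s} Φ_λ(s) ds → c(λ) 2^{−λ}/(k − 2 + λ)` as `x → ∞`. -/
theorem tendsto_exp_mul_tail {k lam : ℝ} (h2 : 2 < k + lam) (hlam : lam < 1) :
    Tendsto (fun x : ℝ => Real.exp ((k - 2 + lam) * x)
        * ∫ s in Ioi x, Real.exp (-((k - 2) * s)) * sphPhase lam s) atTop
      (𝓝 (cfun lam * Real.exp (-(lam * Real.log 2)) / (k - 2 + lam))) := by
  set r : ℝ := k - 2 + lam with hr
  have hr0 : 0 < r := by rw [hr]; linarith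
  set L : ℝ := cfun lam * Real.exp (-(lam * Real.log 2)) with hL
  set h : ℝ → ℝ := fun s => Real.exp (lam * s) * sphPhase lam s with hh
  have hlim : Tendsto h atTop (𝓝 L) := tendsto_exp_mul_sphPhase hlam
  have hcont : Continuous h :=
    (Real.continuous_exp.comp (continuous_const.mul continuous_id)).mul (continuous_sphPhase lam)
  -- a uniform bound for `h` on `[0, ∞)`
  obtain ⟨s0, hs0⟩ : ∃ s0 : ℝ, ∀ s ≥ s0, |h s - L| < 1 :=
    Filter.eventually_atTop.mp (hlim.eventually (eventually_abs_sub_lt L one_pos))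
  obtain ⟨C, hC⟩ := (isCompact_Icc (a := (0 : ℝ)) (b := s0)).exists_bound_of_continuousOn
    hcont.continuousOn
  set B : ℝ := max C (|L| + 1) with hB
  have hbound : ∀ s, 0 ≤ s → |h s| ≤ B := fun s hs => by
    rcases le_or_gt s s0 with hle | hgt
    · exact (hC s ⟨hs, hle⟩).trans (le_max_left _ _)
    · have := hs0 s hgt.le
      calc |h s| = |(h s - L) + L| := by ring_nf
        _ ≤ |h s - L| + |L| := abs_add_le _ _
        _ ≤ |L| + 1 := by linarith
        _ ≤ B := le_max_right _ _
  -- the rewritten tail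
  have e : ∀ x : ℝ, Real.exp (r * x) * ∫ s in Ioi x, Real.exp (-((k - 2) * s)) * sphPhase lam s
      = ∫ v in Ioi (0 : ℝ), Real.exp (-(r * v)) * h (v + x) := fun x => by
    rw [tail_shift (fun s => Real.exp (-((k - 2) * s)) * sphPhase lam s) x, ← integral_const_mul]
    refine integral_congr_ae (Filter.Eventually.of_forall fun v => ?_)
    simp only [hh]
    rw [show Real.exp (r * x) * (Real.exp (-((k - 2) * (v + x))) * sphPhase lam (v + x))
        = (Real.exp (r * x) * Real.exp (-((k - 2) * (v + x)))) * sphPhase lam (v + x) by ring,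
      show Real.exp (-(r * v)) * (Real.exp (lam * (v + x)) * sphPhase lam (v + x))
        = (Real.exp (-(r * v)) * Real.exp (lam * (v + x))) * sphPhase lam (v + x) by ring,
      ← Real.exp_add, ← Real.exp_add]
    congr 2
    rw [hr]
    ring
  -- dominated convergence as `x → ∞`
  have hlim2 := tendsto_integral_filter_of_dominated_convergence (μ := volume.restrict (Ioi (0 : ℝ)))
    (l := atTop) (F := fun x v => Real.exp (-(r * v)) * h (v + x))
    (f := fun v => Real.exp (-(r * v)) * L) (fun v => B * Real.exp (-(r * v)))
    (Filter.Eventually.of_forall fun x => ?_) ?_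
    ((show IntegrableOn (fun v : ℝ => B * Real.exp (-r * v)) (Ioi 0) volume from
      (integrableOn_exp_mul_Ioi (by linarith : -r < 0) 0).const_mul B).congr_fun
      (fun v _ => by simp only; rw [neg_mul]) measurableSet_Ioi) ?_
  · have hr' : r ≠ 0 := hr0.ne'
    have hval : ∫ v in Ioi (0 : ℝ), Real.exp (-(r * v)) * L = L / r := by
      rw [integral_mul_const]
      simp_rw [show ∀ v : ℝ, -(r * v) = -r * v from fun v => (neg_mul r v).symm]
      rw [integral_exp_mul_Ioi (by linarith) 0]
      simp only [mul_zero, Real.exp_zero]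
      field_simp
    rw [hval] at hlim2
    exact hlim2.congr' (Filter.Eventually.of_forall fun x => (e x).symm)
  · exact ((Real.continuous_exp.comp (continuous_const.mul continuous_id).neg).mul
      (hcont.comp (continuous_id.add continuous_const))).aestronglyMeasurable
  · filter_upwards [eventually_ge_atTop (0 : ℝ)] with x hx
    filter_upwards [ae_restrict_mem measurableSet_Ioi] with v hv
    rw [mem_Ioi] at hv
    rw [norm_mul, Real.norm_of_nonneg (Real.exp_pos _).le, Real.norm_eq_abs, mul_comm]
    exact mul_le_mul_of_nonneg_right (hbound (v + x) (by linarith)) (Real.exp_pos _).le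
  · refine Filter.Eventually.of_forall fun v => ?_
    exact tendsto_const_nhds.mul (hlim.comp (tendsto_atTop_add_const_left atTop v tendsto_id))

/-- **On the group**: for `k` on the ray and `λ < 1`,
`e^{(k−2+λ)x} P_{k,λ}(log|a| > x) → 2π c(λ) 2^{−λ}/((k − 2 + λ) m̂_k(λ))` as `x → ∞`. -/
theorem tendsto_exp_mul_tail_prob {k lam : ℝ} (hk : 1 < k) (h1 : lam < k) (h2 : 2 < k + lam)
    (hlam : lam < 1) :
    Tendsto (fun x : ℝ => Real.exp ((k - 2 + lam) * x)
        * ((∫ g in {g : SU11 | x < Real.log ‖mat g 0 0‖},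
            (1 - ‖orbit g‖ ^ 2) ^ (k / 2) * sph lam g ∂(nu haarCircle))
          / ∫ g, (1 - ‖orbit g‖ ^ 2) ^ (k / 2) * sph lam g ∂(nu haarCircle))) atTop
      (𝓝 (2 * π * (cfun lam * Real.exp (-(lam * Real.log 2)) / (k - 2 + lam))
        / ∫ g, (1 - ‖orbit g‖ ^ 2) ^ (k / 2) * sph lam g ∂(nu haarCircle))) := by
  have h := ((tendsto_exp_mul_tail h2 hlam).const_mul (2 * π)).div_const
    (∫ g, (1 - ‖orbit g‖ ^ 2) ^ (k / 2) * sph lam g ∂(nu haarCircle))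
  refine h.congr' ?_
  filter_upwards [eventually_ge_atTop (0 : ℝ)] with x hx
  rw [integral_phase_tail_eq hk h1 h2 hx]
  ring

/-- **The rate `k − λ` for `λ > 1`** (the `W`-symmetry `Φ_λ = Φ_{2−λ}`): for `λ < k`, `λ > 1`,
`e^{(k−λ)x} ∫_x^∞ e^{−(k−2)s} Φ_λ(s) ds → c(2 − λ) 2^{−(2−λ)}/(k − λ)`. -/
theorem tendsto_exp_mul_tail' {k lam : ℝ} (h1 : lam < k) (hlam : 1 < lam) :
    Tendsto (fun x : ℝ => Real.exp ((k - lam) * x)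
        * ∫ s in Ioi x, Real.exp (-((k - 2) * s)) * sphPhase lam s) atTop
      (𝓝 (cfun (2 - lam) * Real.exp (-((2 - lam) * Real.log 2)) / (k - lam))) := by
  have h := tendsto_exp_mul_tail (k := k) (lam := 2 - lam) (by linarith) (by linarith)
  rw [show k - 2 + (2 - lam) = k - lam by ring] at h
  refine h.congr' (Filter.Eventually.of_forall fun x => ?_)
  congr 1
  refine setIntegral_congr_fun measurableSet_Ioi fun s _ => ?_
  rw [sphPhase_two_sub lam s]

end measure

end Summit.Ventures.HodgeRepro2.T5SU11JacobiPhaseTailRate
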